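import Mathlib.Analysis.Complex.ExponentialBounds
import Literature.NumberTheory.Transcendental.SixExponentialsSeveralVariablesSteps
import HarnessLib

/-!
# Waldschmidt 1981, §3: the auxiliary function (Corollaire 3.2), proved

Topic `Literature/NumberTheory/Transcendental`; sibling proof file of
`SixExponentialsSeveralVariablesSteps.lean`, which vendors the named fact
`Waldschmidt1981.cor_3_2` = [Waldschmidt1981, §3 Corollaire 3.2 (pp. 101–102)]:

> "Soient `x₁, …, x_d` des éléments de `ℂⁿ`, avec `d > n`. Il existe un entier `N₀ > 0`, et une
> suite `(P_N)_{N ≥ N₀}` de polynômes non nuls de `ℤ[T₁, …, T_d]`, avec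
> `deg_{Tᵢ} P_N < N^{n/(d−n)} (log N)^{n+2}` `(1 ≤ i ≤ d)`,
> `log H(P_N) ≤ N^{d/(d−n)} (log N)^{n+2}`, telle que les fonctions
> `F_N(z) = P_N(e^{⟨x₁,z⟩}, …, e^{⟨x_d,z⟩})` vérifient `|F_N|_N ≤ exp{−N^{d/(d−n)} (log N)^{d+2}}`."

This file PROVES it (`cor_3_2_holds : cor_3_2`), sorry-free, from Mathlib. The point of the
source's §3 ("fonction auxiliaire générale", Théorème 3.1) is that `P_N` has rational integer
coefficients although the `xᵢ` are arbitrary complex vectors: no vanishing can be imposed, and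
the construction is Dirichlet's box principle (Thue–Siegel) making the low-order Taylor
coefficients of `F_N` at the origin SMALL, the high-order ones being small by the decay of the
exponential series. Concretely, with `F(z) = ∑_λ p(λ) e^{⟨w_λ, z⟩}`,
`w_λ = λ₁x₁ + ⋯ + λ_d x_d` (`0 ≤ λᵢ < D`) and `e^{⟨w, z⟩} = ∏_m e^{w_m z_m}`:

* `box_principle_real`, `box_principle_complex` — for real (complex) `a_{ij}` with
  `|a_{ij}| ≤ A` and `k^{#rows} < (P+1)^{#cols}` (twice the rows in the complex case) there are
  integers `p_j`, not all zero, `|p_j| ≤ P`, with `|∑_j p_j a_{ij}| ≤ (2·#cols·A·P + 1)/k`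
  (pigeonhole on the tuples `0 ≤ q_j ≤ P`);
* `norm_exp_sub_partialSum_le` (`‖e^a − ∑_{k<T} a^k/k!‖ ≤ 2e^{−T}` for `‖a‖ ≤ ρ`, `8ρ ≤ T`,
  Mathlib's `Complex.exp_bound'` and `T! ≥ (T/e)^T`), `norm_prod_sub_prod_le` (telescoping),
  `norm_expPoly_le` — the analytic half: if every truncated Taylor coefficient
  `∑_λ p(λ) ∏_m (w_{λ,m} N)^{κ_m}/κ_m!` (`κ_m < T`) has modulus `≤ ε`, then
  `|F|_N ≤ Tⁿ ε + #Λ · max|p| · n e^{nρ} · 2e^{−T}` (sup norm on `ℂⁿ`, as in the vendored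
  statement);
* `coeff_auxPoly_expnt`, `degreeOf_auxPoly_lt`, `aeval_auxPoly`, `prod_cexp_dotProduct_pow`,
  `norm_freq_le` — `P = ∑_λ p(λ) T^λ` (a sum of monomials; no new definition is introduced),
  its coefficients, partial degrees and values `P(e^{⟨xᵢ,z⟩}) = ∑_λ p(λ) e^{⟨w_λ,z⟩}`;
* `card_ineq`, `final_bound`, `cor_3_2_holds` — the parameters: `ℓ = log N`,
  `D = ⌈N^{n/(d−n)} ℓ^{n+2}⌉`, `H₀ = N^{d/(d−n)} ℓ^{n+2}`, `P = ⌊e^{H₀}⌋`,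
  `U = N^{d/(d−n)} ℓ^{d+2}`, `ρ = dD‖x‖N`, `T = ⌈8ρ + U + H₀ + nρ + dD + n + 2⌉`,
  `V = U + H₀ + nρ + dD + nT + 4`, `k = ⌊e^V⌋`; the count `k^{2Tⁿ} < (P+1)^{D^d}` follows
  from `2TⁿV ≤ D^d H₀`, which holds with one spare factor `ℓ^{d−n} ≥ ℓ` once
  `ℓ ≥ c₁(n, d, ‖x‖), 2^{n+2}(n+1)` (this is where `(N^{n/(d−n)})^{d−n} = Nⁿ` is used),
  whence `N₀`.

Constants are not optimised (the statement fixes the exponents, not the constants; the slack is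
a power of `log N`). Nothing here is specific to `n ≥ 1`: for `n = 0` the box principle acts on
the two rows `Re`, `Im` of the single coefficient `∑_λ p(λ)`.

## References

* [Waldschmidt1981] M. Waldschmidt, *Transcendance et exponentielles en plusieurs variables*,
  Invent. Math. 63 (1981) 97–127, §3 Théorème 3.1 (pp. 100–101), Corollaire 3.2 (pp. 101–102).
-/

noncomputable section

open Complex Finset

namespace Literature.NumberTheory.Transcendental.Waldschmidt1981

/-! ### The box principle (Dirichlet–Thue–Siegel, "small values" form) -/

/-- Two nonnegative reals with the same integer part differ by less than `1`. [folklore] -/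
theorem abs_sub_lt_one_of_floor_eq {u v : ℝ} (hu : 0 ≤ u) (hv : 0 ≤ v) (h : ⌊u⌋₊ = ⌊v⌋₊) :
    |u - v| < 1 := by
  have h1 := Nat.lt_floor_add_one u
  have h2 := Nat.lt_floor_add_one v
  have h3 := Nat.floor_le hu
  have h4 := Nat.floor_le hv
  rw [h] at h1 h3
  rw [abs_lt]
  constructor <;> linarith

/-- **The box principle for real linear forms.** Let `a_{ij}` (`i ∈ ι`, `j ∈ κ`) be real numbers
with `|a_{ij}| ≤ A`, and `P, k ≥ 1` integers with `k^{#ι} < (P+1)^{#κ}`. Then there are rational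
integers `p_j`, not all zero, with `|p_j| ≤ P` and `|∑_j p_j a_{ij}| ≤ (2 #κ A P + 1)/k` for every
`i` (pigeonhole on the `(P+1)^{#κ}` tuples `0 ≤ q_j ≤ P`). [folklore] -/
theorem box_principle_real {ι κ : Type*} [Fintype ι] [Fintype κ]
    (a : ι → κ → ℝ) {A : ℝ} (hA0 : 0 ≤ A) (hA : ∀ i j, |a i j| ≤ A)
    (P k : ℕ) (hk : 0 < k) (hcard : k ^ Fintype.card ι < (P + 1) ^ Fintype.card κ) :
    ∃ p : κ → ℤ, p ≠ 0 ∧ (∀ j, |p j| ≤ P) ∧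
      ∀ i, |∑ j, (p j : ℝ) * a i j| ≤ (2 * Fintype.card κ * A * P + 1) / k := by
  classical
  set B : ℝ := Fintype.card κ * A * P with hB
  have hB0 : 0 ≤ B := by positivity
  have hk0 : (0 : ℝ) < k := Nat.cast_pos.mpr hk
  set δ : ℝ := (2 * B + 1) / k with hδ
  have hδ0 : 0 < δ := by positivity
  have hkδ : (k : ℝ) * δ = 2 * B + 1 := by
    rw [hδ]; field_simp
  -- the linear forms at the lattice points `0 ≤ q_j ≤ P`
  set L : ι → (κ → Fin (P + 1)) → ℝ := fun i q => ∑ j, ((q j : ℕ) : ℝ) * a i j with hL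
  have hLB : ∀ i q, |L i q| ≤ B := by
    intro i q
    calc |L i q| ≤ ∑ j, |((q j : ℕ) : ℝ) * a i j| := Finset.abs_sum_le_sum_abs _ _
      _ ≤ ∑ _j : κ, (P : ℝ) * A := Finset.sum_le_sum fun j _ => by
          rw [abs_mul, Nat.abs_cast, mul_comm]
          have hq : ((q j : ℕ) : ℝ) ≤ P := by exact_mod_cast Nat.lt_succ_iff.mp (q j).isLt
          calc |a i j| * ((q j : ℕ) : ℝ) ≤ A * P :=
                mul_le_mul (hA i j) hq (Nat.cast_nonneg _) hA0
            _ = P * A := mul_comm _ _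
      _ = B := by
          rw [Finset.sum_const, Finset.card_univ, nsmul_eq_mul, hB]; ring
  set box : (κ → Fin (P + 1)) → ι → ℕ := fun q i => ⌊(L i q + B) / δ⌋₊ with hbox
  have hmaps : ∀ q ∈ (Finset.univ : Finset (κ → Fin (P + 1))),
      box q ∈ Fintype.piFinset fun _ : ι => Finset.range k := by
    intro q _
    rw [Fintype.mem_piFinset]
    intro i
    rw [Finset.mem_range, hbox]
    dsimp only
    have hnn : 0 ≤ (L i q + B) / δ :=
      div_nonneg (by have := (abs_le.mp (hLB i q)).1; linarith) hδ0.le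
    rw [Nat.floor_lt hnn, div_lt_iff₀ hδ0, hkδ]
    have := (abs_le.mp (hLB i q)).2
    linarith
  have hcard' : (Fintype.piFinset fun _ : ι => Finset.range k).card <
      (Finset.univ : Finset (κ → Fin (P + 1))).card := by
    rw [Fintype.card_piFinset, Finset.prod_const, Finset.card_range, Finset.card_univ,
      Finset.card_univ, Fintype.card_pi, Finset.prod_const, Fintype.card_fin, Finset.card_univ]
    exact hcard
  obtain ⟨q, -, q', -, hne, heq⟩ := Finset.exists_ne_map_eq_of_card_lt_of_maps_to hcard' hmaps
  refine ⟨fun j => ((q j : ℕ) : ℤ) - ((q' j : ℕ) : ℤ), ?_, ?_, ?_⟩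
  · intro h0
    apply hne
    funext j
    have hj := congr_fun h0 j
    simp only [Pi.zero_apply, sub_eq_zero, Nat.cast_inj] at hj
    exact Fin.ext hj
  · intro j
    have h1 : ((q j : ℕ) : ℤ) ≤ P := by exact_mod_cast Nat.lt_succ_iff.mp (q j).isLt
    have h2 : ((q' j : ℕ) : ℤ) ≤ P := by exact_mod_cast Nat.lt_succ_iff.mp (q' j).isLt
    have h3 : (0 : ℤ) ≤ ((q j : ℕ) : ℤ) := by positivity
    have h4 : (0 : ℤ) ≤ ((q' j : ℕ) : ℤ) := by positivity
    rw [abs_le]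
    constructor <;> linarith
  · intro i
    have hdiff :
        ∑ j, (((((q j : ℕ) : ℤ) - ((q' j : ℕ) : ℤ) : ℤ)) : ℝ) * a i j = L i q - L i q' := by
      simp only [hL, Int.cast_sub, Int.cast_natCast, sub_mul, Finset.sum_sub_distrib]
    rw [hdiff]
    have hbi : box q i = box q' i := congr_fun heq i
    simp only [hbox] at hbi
    have hu : 0 ≤ (L i q + B) / δ :=
      div_nonneg (by have := (abs_le.mp (hLB i q)).1; linarith) hδ0.le
    have hv : 0 ≤ (L i q' + B) / δ :=
      div_nonneg (by have := (abs_le.mp (hLB i q')).1; linarith) hδ0.le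
    have hlt := abs_sub_lt_one_of_floor_eq hu hv hbi
    rw [← sub_div, abs_div, abs_of_pos hδ0, div_lt_one hδ0] at hlt
    have : L i q + B - (L i q' + B) = L i q - L i q' := by ring
    rw [this] at hlt
    have hε : (2 * (Fintype.card κ : ℝ) * A * P + 1) / k = δ := by rw [hδ, hB]; ring
    rw [hε]
    exact hlt.le

/-- **The box principle for complex linear forms** (real and imaginary parts): with
`‖a_{ij}‖ ≤ A` and `k^{2#ι} < (P+1)^{#κ}` there are integers `p_j`, not all zero, `|p_j| ≤ P`,
with `‖∑_j p_j a_{ij}‖ ≤ 2(2 #κ A P + 1)/k`. [folklore] -/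
theorem box_principle_complex {ι κ : Type*} [Fintype ι] [Fintype κ]
    (a : ι → κ → ℂ) {A : ℝ} (hA0 : 0 ≤ A) (hA : ∀ i j, ‖a i j‖ ≤ A)
    (P k : ℕ) (hk : 0 < k) (hcard : k ^ (2 * Fintype.card ι) < (P + 1) ^ Fintype.card κ) :
    ∃ p : κ → ℤ, p ≠ 0 ∧ (∀ j, |p j| ≤ P) ∧
      ∀ i, ‖∑ j, (p j : ℂ) * a i j‖ ≤ 2 * ((2 * Fintype.card κ * A * P + 1) / k) := by
  classical
  set a' : ι ⊕ ι → κ → ℝ := fun s j => Sum.elim (fun i => (a i j).re) (fun i => (a i j).im) s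
    with ha'
  have hA' : ∀ s j, |a' s j| ≤ A := by
    rintro (i | i) j
    · exact (Complex.abs_re_le_norm _).trans (hA i j)
    · exact (Complex.abs_im_le_norm _).trans (hA i j)
  have hcard' : k ^ Fintype.card (ι ⊕ ι) < (P + 1) ^ Fintype.card κ := by
    rwa [Fintype.card_sum, ← two_mul]
  obtain ⟨p, hp0, hpP, hpL⟩ := box_principle_real a' hA0 hA' P k hk hcard'
  refine ⟨p, hp0, hpP, fun i => ?_⟩
  have hre : (∑ j, (p j : ℂ) * a i j).re = ∑ j, (p j : ℝ) * a' (Sum.inl i) j := by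
    simp [Complex.re_sum, ha']
  have him : (∑ j, (p j : ℂ) * a i j).im = ∑ j, (p j : ℝ) * a' (Sum.inr i) j := by
    simp [Complex.im_sum, ha']
  calc ‖∑ j, (p j : ℂ) * a i j‖
      ≤ |(∑ j, (p j : ℂ) * a i j).re| + |(∑ j, (p j : ℂ) * a i j).im| :=
        Complex.norm_le_abs_re_add_abs_im _
    _ ≤ (2 * Fintype.card κ * A * P + 1) / k + (2 * Fintype.card κ * A * P + 1) / k :=
        add_le_add (by rw [hre]; exact hpL _) (by rw [him]; exact hpL _)
    _ = 2 * ((2 * Fintype.card κ * A * P + 1) / k) := by ring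

/-! ### Truncated exponential series -/

/-- Partial sums of the exponential series are bounded by the exponential of the modulus.
[folklore] -/
theorem norm_expPartialSum_le (a : ℂ) (T : ℕ) :
    ‖∑ k : Fin T, a ^ (k : ℕ) / ((k : ℕ).factorial : ℂ)‖ ≤ Real.exp ‖a‖ := by
  rw [← Finset.sum_range fun k => a ^ k / (k.factorial : ℂ)]
  calc ‖∑ k ∈ range T, a ^ k / (k.factorial : ℂ)‖
      ≤ ∑ k ∈ range T, ‖a ^ k / (k.factorial : ℂ)‖ := norm_sum_le _ _
    _ = ∑ k ∈ range T, ‖a‖ ^ k / k.factorial := by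
        refine Finset.sum_congr rfl fun k _ => ?_
        rw [norm_div, norm_pow, Complex.norm_natCast]
    _ ≤ Real.exp ‖a‖ := Real.sum_le_exp_of_nonneg (norm_nonneg _) _

/-- Tail of the exponential series: if `‖a‖ ≤ ρ`, `8ρ ≤ T` and `T ≥ 1`, then
`‖e^a − ∑_{k<T} a^k/k!‖ ≤ 2e^{−T}` (from `‖e^a − ∑_{k<T} a^k/k!‖ ≤ 2‖a‖^T/T!` and
`T! ≥ (T/e)^T`). [folklore] -/
theorem norm_exp_sub_partialSum_le {a : ℂ} {ρ : ℝ} {T : ℕ} (ha : ‖a‖ ≤ ρ) (hT : 8 * ρ ≤ T)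
    (hT1 : 1 ≤ T) :
    ‖cexp a - ∑ k : Fin T, a ^ (k : ℕ) / ((k : ℕ).factorial : ℂ)‖ ≤ 2 * Real.exp (-T) := by
  rw [← Finset.sum_range fun k => a ^ k / (k.factorial : ℂ)]
  have hT0 : (0 : ℝ) < T := by exact_mod_cast hT1
  have hx : ‖a‖ / (T.succ : ℕ) ≤ 1 / 2 := by
    rw [div_le_iff₀ (by positivity)]
    push_cast
    linarith [norm_nonneg a]
  have h1 := Complex.exp_bound' hx
  have he8 : Real.exp 2 ≤ 8 := by
    have h := Real.exp_one_lt_d9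
    have h2 : Real.exp 2 = Real.exp 1 ^ 2 := by
      rw [← Real.exp_nat_mul]; norm_num
    rw [h2]
    nlinarith [Real.exp_pos 1]
  have h8 : Real.exp 1 / 8 ≤ Real.exp (-1) := by
    rw [div_le_iff₀ (by norm_num : (0 : ℝ) < 8)]
    calc Real.exp 1 = Real.exp (-1) * Real.exp 2 := by rw [← Real.exp_add]; norm_num
      _ ≤ Real.exp (-1) * 8 := by gcongr
  have h2 : ‖a‖ ^ T / T.factorial ≤ Real.exp (-T) := by
    have hfac : (T : ℝ) ^ T / T.factorial ≤ Real.exp T := Real.pow_div_factorial_le_exp _ hT0.le T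
    have hexpT : Real.exp (T : ℝ) = Real.exp 1 ^ T := by rw [← Real.exp_nat_mul, mul_one]
    have h3 : ‖a‖ ^ T ≤ ((T : ℝ) / 8) ^ T := pow_le_pow_left₀ (norm_nonneg _) (by linarith) T
    calc ‖a‖ ^ T / T.factorial ≤ ((T : ℝ) / 8) ^ T / T.factorial := by gcongr
      _ = (1 / 8) ^ T * ((T : ℝ) ^ T / T.factorial) := by rw [div_pow, div_pow]; ring
      _ ≤ (1 / 8) ^ T * Real.exp T := by gcongr
      _ = (Real.exp 1 / 8) ^ T := by
          rw [hexpT, div_pow, div_pow, one_pow]; ring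
      _ ≤ Real.exp (-1) ^ T := pow_le_pow_left₀ (by positivity) h8 T
      _ = Real.exp (-T) := by rw [← Real.exp_nat_mul]; ring_nf
  linarith

/-- Telescoping for products: if `‖f_m‖, ‖g_m‖ ≤ M` (`M ≥ 1`) and `‖f_m − g_m‖ ≤ δ` on `s`, then
`‖∏_s f − ∏_s g‖ ≤ #s · M^{#s} · δ`. [folklore] -/
theorem norm_prod_sub_prod_le {α : Type*} (s : Finset α) (f g : α → ℂ) {M δ : ℝ} (hM : 1 ≤ M)
    (hδ : 0 ≤ δ) (hf : ∀ m ∈ s, ‖f m‖ ≤ M) (hg : ∀ m ∈ s, ‖g m‖ ≤ M)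
    (hfg : ∀ m ∈ s, ‖f m - g m‖ ≤ δ) :
    ‖∏ m ∈ s, f m - ∏ m ∈ s, g m‖ ≤ s.card * M ^ s.card * δ := by
  classical
  induction s using Finset.induction_on with
  | empty => simp
  | insert a s ha ih =>
    have hf' : ∀ m ∈ s, ‖f m‖ ≤ M := fun m hm => hf m (Finset.mem_insert_of_mem hm)
    have hg' : ∀ m ∈ s, ‖g m‖ ≤ M := fun m hm => hg m (Finset.mem_insert_of_mem hm)
    have hfg' : ∀ m ∈ s, ‖f m - g m‖ ≤ δ := fun m hm => hfg m (Finset.mem_insert_of_mem hm)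
    have ih' := ih hf' hg' hfg'
    have hM0 : 0 ≤ M := zero_le_one.trans hM
    have hPg : ‖∏ m ∈ s, g m‖ ≤ M ^ s.card := by
      rw [norm_prod]
      calc ∏ m ∈ s, ‖g m‖ ≤ ∏ _m ∈ s, M :=
            Finset.prod_le_prod (fun _ _ => norm_nonneg _) fun m hm => hg' m hm
        _ = M ^ s.card := Finset.prod_const M
    rw [Finset.prod_insert ha, Finset.prod_insert ha, Finset.card_insert_of_notMem ha]
    have hsplit : f a * ∏ m ∈ s, f m - g a * ∏ m ∈ s, g m =
        f a * (∏ m ∈ s, f m - ∏ m ∈ s, g m) + (f a - g a) * ∏ m ∈ s, g m := by ring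
    rw [hsplit]
    calc ‖f a * (∏ m ∈ s, f m - ∏ m ∈ s, g m) + (f a - g a) * ∏ m ∈ s, g m‖
        ≤ ‖f a‖ * ‖∏ m ∈ s, f m - ∏ m ∈ s, g m‖ + ‖f a - g a‖ * ‖∏ m ∈ s, g m‖ := by
          refine (norm_add_le _ _).trans ?_
          rw [norm_mul, norm_mul]
      _ ≤ M * (s.card * M ^ s.card * δ) + δ * M ^ s.card := by
          apply add_le_add
          · exact mul_le_mul (hf a (Finset.mem_insert_self a s)) ih' (norm_nonneg _) hM0
          · exact mul_le_mul (hfg a (Finset.mem_insert_self a s)) hPg (norm_nonneg _) hδ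
      _ ≤ (↑(s.card + 1) : ℝ) * M ^ (s.card + 1) * δ := by
          have hpow : M ^ s.card ≤ M ^ (s.card + 1) := pow_le_pow_right₀ hM (Nat.le_succ _)
          push_cast
          rw [pow_succ]
          nlinarith [pow_nonneg hM0 s.card, mul_nonneg (pow_nonneg hM0 s.card) hδ]

/-- `‖∏_{m∈s} e^{a_m} − ∏_{m∈s} ∑_{k<T} a_m^k/k!‖ ≤ #s · e^{#s ρ} · 2e^{−T}` when `‖a_m‖ ≤ ρ`,
`8ρ ≤ T`, `T ≥ 1`. [folklore] -/
theorem norm_prod_exp_sub_prod_partialSum_le {α : Type*} (s : Finset α) (a : α → ℂ) {ρ : ℝ}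
    {T : ℕ} (hρ : 0 ≤ ρ) (ha : ∀ m ∈ s, ‖a m‖ ≤ ρ) (hT : 8 * ρ ≤ T) (hT1 : 1 ≤ T) :
    ‖∏ m ∈ s, cexp (a m) - ∏ m ∈ s, ∑ k : Fin T, a m ^ (k : ℕ) / ((k : ℕ).factorial : ℂ)‖ ≤
      s.card * Real.exp ρ ^ s.card * (2 * Real.exp (-T)) :=
  norm_prod_sub_prod_le s _ _ (Real.one_le_exp hρ) (by positivity)
    (fun m hm => (Complex.norm_exp_le_exp_norm _).trans (Real.exp_le_exp.mpr (ha m hm)))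
    (fun m hm => (norm_expPartialSum_le _ _).trans (Real.exp_le_exp.mpr (ha m hm)))
    (fun m hm => norm_exp_sub_partialSum_le (ha m hm) hT hT1)

/-- Factoring the variables out of a truncated Taylor coefficient. [folklore] -/
theorem sum_mul_prod_mul_pow_div {n : ℕ} {Λ : Type*} [Fintype Λ] (w : Λ → Fin n → ℂ)
    (p : Λ → ℤ) (v : Fin n → ℂ) (κ : Fin n → ℕ) :
    ∑ l, (p l : ℂ) * ∏ m, (w l m * v m) ^ κ m / ((κ m).factorial : ℂ) =
      (∑ l, (p l : ℂ) * ∏ m, w l m ^ κ m / ((κ m).factorial : ℂ)) * ∏ m, v m ^ κ m := by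
  rw [Finset.sum_mul]
  refine Finset.sum_congr rfl fun l _ => ?_
  rw [mul_assoc, ← Finset.prod_mul_distrib]
  congr 1
  refine Finset.prod_congr rfl fun m _ => ?_
  rw [mul_pow]; ring

/-- **The analytic half of Corollaire 3.2.** For `F(z) = ∑_λ p_λ e^{⟨w_λ, z⟩}` with
`‖w_{λ,m}‖ N ≤ ρ`, `|p_λ| ≤ P`, `8ρ ≤ T`, and all truncated Taylor coefficients
`∑_λ p_λ ∏_m (w_{λ,m} N)^{κ_m}/κ_m!` (`κ_m < T`) of modulus `≤ ε`:
`|F|_N ≤ Tⁿ ε + #Λ · P · n e^{nρ} · 2e^{−T}` (sup norm on `ℂⁿ`). [folklore] -/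
theorem norm_expPoly_le {n : ℕ} {Λ : Type*} [Fintype Λ] (w : Λ → Fin n → ℂ) (p : Λ → ℤ)
    (N T Pb : ℕ) {ρ ε : ℝ} (hρ : 0 ≤ ρ) (hT : 8 * ρ ≤ T) (hT1 : 1 ≤ T)
    (hw : ∀ l m, ‖w l m‖ * N ≤ ρ) (hp : ∀ l, |p l| ≤ Pb)
    (hε : ∀ κ : Fin n → Fin T,
      ‖∑ l, (p l : ℂ) * ∏ m, (w l m * N) ^ (κ m : ℕ) / ((κ m : ℕ).factorial : ℂ)‖ ≤ ε)
    (z : Fin n → ℂ) (hz : ‖z‖ ≤ N) :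
    ‖∑ l, (p l : ℂ) * cexp (w l ⬝ᵥ z)‖ ≤
      (T : ℝ) ^ n * ε + Fintype.card Λ * Pb * (n * Real.exp ρ ^ n * (2 * Real.exp (-T))) := by
  have hzm : ∀ m, ‖z m‖ ≤ N := fun m => (norm_le_pi_norm z m).trans hz
  have ha : ∀ l m, ‖w l m * z m‖ ≤ ρ := fun l m => by
    rw [norm_mul]
    exact (mul_le_mul_of_nonneg_left (hzm m) (norm_nonneg _)).trans (hw l m)
  have hexp : ∀ l, cexp (w l ⬝ᵥ z) = ∏ m, cexp (w l m * z m) := fun l => by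
    rw [dotProduct, Complex.exp_sum]
  -- the truncated products
  set S : Λ → ℂ := fun l => ∏ m, ∑ k : Fin T, (w l m * z m) ^ (k : ℕ) / ((k : ℕ).factorial : ℂ)
    with hS
  -- the main term, reorganised by monomials in `z`
  set c : (Fin n → Fin T) → ℂ := fun κ =>
    ∑ l, (p l : ℂ) * ∏ m, w l m ^ (κ m : ℕ) / ((κ m : ℕ).factorial : ℂ) with hc
  have hmain : ∑ l, (p l : ℂ) * S l = ∑ κ : Fin n → Fin T, c κ * ∏ m, z m ^ (κ m : ℕ) := by
    have h1 : ∀ l, S l = ∑ κ : Fin n → Fin T,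
        ∏ m, (w l m * z m) ^ (κ m : ℕ) / ((κ m : ℕ).factorial : ℂ) := by
      intro l
      simp only [hS]
      rw [Finset.prod_univ_sum (fun _ : Fin n => (Finset.univ : Finset (Fin T)))
        (fun m (k : Fin T) => (w l m * z m) ^ (k : ℕ) / ((k : ℕ).factorial : ℂ)),
        Fintype.piFinset_univ]
    simp_rw [h1, Finset.mul_sum]
    rw [Finset.sum_comm]
    refine Finset.sum_congr rfl fun κ _ => ?_
    rw [hc]
    exact sum_mul_prod_mul_pow_div w p z (fun m => (κ m : ℕ))
  -- bound for the main term
  have hmain_le : ‖∑ l, (p l : ℂ) * S l‖ ≤ (T : ℝ) ^ n * ε := by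
    rw [hmain]
    calc ‖∑ κ : Fin n → Fin T, c κ * ∏ m, z m ^ (κ m : ℕ)‖
        ≤ ∑ κ : Fin n → Fin T, ‖c κ * ∏ m, z m ^ (κ m : ℕ)‖ := norm_sum_le _ _
      _ ≤ ∑ _κ : Fin n → Fin T, ε := Finset.sum_le_sum fun κ _ => by
          have hN : ‖c κ * ∏ m, ((N : ℂ)) ^ (κ m : ℕ)‖ ≤ ε := by
            rw [hc, ← sum_mul_prod_mul_pow_div w p (fun _ => (N : ℂ)) (fun m => (κ m : ℕ))]
            exact hε κ
          refine le_trans ?_ hN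
          rw [norm_mul, norm_mul, norm_prod, norm_prod]
          gcongr with m _
          rw [norm_pow, norm_pow, Complex.norm_natCast]
          exact pow_le_pow_left₀ (norm_nonneg _) (hzm m) _
      _ = (T : ℝ) ^ n * ε := by
          rw [Finset.sum_const, Finset.card_univ, Fintype.card_pi, Finset.prod_const,
            Fintype.card_fin, Finset.card_univ, Fintype.card_fin, nsmul_eq_mul, Nat.cast_pow]
  -- bound for the remainder
  have hrem_le : ‖∑ l, (p l : ℂ) * cexp (w l ⬝ᵥ z) - ∑ l, (p l : ℂ) * S l‖ ≤
      Fintype.card Λ * Pb * (n * Real.exp ρ ^ n * (2 * Real.exp (-T))) := by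
    rw [← Finset.sum_sub_distrib]
    calc ‖∑ l, ((p l : ℂ) * cexp (w l ⬝ᵥ z) - (p l : ℂ) * S l)‖
        ≤ ∑ l, ‖(p l : ℂ) * cexp (w l ⬝ᵥ z) - (p l : ℂ) * S l‖ := norm_sum_le _ _
      _ ≤ ∑ _l : Λ, (Pb : ℝ) * (n * Real.exp ρ ^ n * (2 * Real.exp (-T))) :=
          Finset.sum_le_sum fun l _ => by
            rw [← mul_sub, norm_mul, hexp l, hS]
            refine mul_le_mul ?_ ?_ (norm_nonneg _) (Nat.cast_nonneg _)
            · rw [Complex.norm_intCast]; exact_mod_cast hp l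
            · have := norm_prod_exp_sub_prod_partialSum_le (Finset.univ : Finset (Fin n))
                (fun m => w l m * z m) hρ (fun m _ => ha l m) hT hT1
              simpa only [Finset.card_univ, Fintype.card_fin] using this
      _ = Fintype.card Λ * Pb * (n * Real.exp ρ ^ n * (2 * Real.exp (-T))) := by
          rw [Finset.sum_const, Finset.card_univ, nsmul_eq_mul]; ring
  calc ‖∑ l, (p l : ℂ) * cexp (w l ⬝ᵥ z)‖
      = ‖∑ l, (p l : ℂ) * S l + (∑ l, (p l : ℂ) * cexp (w l ⬝ᵥ z) - ∑ l, (p l : ℂ) * S l)‖ := by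
        congr 1; ring
    _ ≤ ‖∑ l, (p l : ℂ) * S l‖ + ‖∑ l, (p l : ℂ) * cexp (w l ⬝ᵥ z) - ∑ l, (p l : ℂ) * S l‖ :=
        norm_add_le _ _
    _ ≤ _ := add_le_add hmain_le hrem_le

/-! ### The auxiliary polynomial `P = ∑_λ p(λ) T^λ` -/

section AuxPoly

variable {d D : ℕ} {e : (Fin d → Fin D) → Fin d →₀ ℕ}

/-! Throughout, `e λ` is the exponent vector `(λ₁, …, λ_d)` of an index `λ : Fin d → Fin D`
(hypothesis `he : ∀ λ i, e λ i = λᵢ`; in the application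
`e λ = Finsupp.equivFunOnFinite.symm (fun i => λᵢ)`), and the auxiliary polynomial is
`P = ∑_λ p(λ) T^{e λ} ∈ ℤ[T₁, …, T_d]`. -/

/-- The exponent map `λ ↦ (λ₁, …, λ_d)` is injective. [folklore] -/
theorem expnt_injective (he : ∀ l i, e l i = (l i : ℕ)) : Function.Injective e := by
  intro l l' h
  funext i
  apply Fin.ext
  rw [← he l i, ← he l' i, h]

/-- The coefficient of `T^λ` in `P = ∑_λ p(λ) T^λ` is `p(λ)`. [folklore] -/
theorem coeff_auxPoly_expnt (he : ∀ l i, e l i = (l i : ℕ)) (p : (Fin d → Fin D) → ℤ)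
    (l : Fin d → Fin D) :
    (∑ l', MvPolynomial.monomial (e l') (p l')).coeff (e l) = p l := by
  classical
  simp only [MvPolynomial.coeff_sum, MvPolynomial.coeff_monomial]
  rw [Finset.sum_eq_single l]
  · simp
  · intro b _ hb
    rw [if_neg]
    exact fun h => hb (expnt_injective he h)
  · intro h
    exact absurd (Finset.mem_univ l) h

/-- Exponents not of the form `(λ₁, …, λ_d)` do not occur in `P`. [folklore] -/
theorem coeff_auxPoly_eq_zero (p : (Fin d → Fin D) → ℤ) (m : Fin d →₀ ℕ)
    (hm : ∀ l : Fin d → Fin D, e l ≠ m) :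
    (∑ l, MvPolynomial.monomial (e l) (p l)).coeff m = 0 := by
  classical
  simp only [MvPolynomial.coeff_sum, MvPolynomial.coeff_monomial]
  exact Finset.sum_eq_zero fun l _ => if_neg (hm l)

/-- The coefficients of `P` are bounded by the bound for the `p(λ)` ("`H(P) ≤ max |p(λ)|`").
[folklore] -/
theorem abs_coeff_auxPoly_le (he : ∀ l i, e l i = (l i : ℕ)) (p : (Fin d → Fin D) → ℤ)
    {Pb : ℕ} (hp : ∀ l, |p l| ≤ Pb) (m : Fin d →₀ ℕ) :
    |(∑ l, MvPolynomial.monomial (e l) (p l)).coeff m| ≤ Pb := by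
  by_cases h : ∃ l : Fin d → Fin D, e l = m
  · obtain ⟨l, rfl⟩ := h
    rw [coeff_auxPoly_expnt he]
    exact hp l
  · push Not at h
    rw [coeff_auxPoly_eq_zero p m h, abs_zero]
    exact Nat.cast_nonneg _

/-- `P ≠ 0` as soon as some `p(λ) ≠ 0`. [folklore] -/
theorem auxPoly_ne_zero (he : ∀ l i, e l i = (l i : ℕ)) (p : (Fin d → Fin D) → ℤ)
    (hp : p ≠ 0) : ∑ l, MvPolynomial.monomial (e l) (p l) ≠ 0 := by
  obtain ⟨l, hl⟩ := Function.ne_iff.mp hp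
  intro h0
  have := coeff_auxPoly_expnt he p l
  rw [h0, MvPolynomial.coeff_zero] at this
  exact hl this.symm

/-- `deg_{Tᵢ} P < D`. [folklore] -/
theorem degreeOf_auxPoly_lt (he : ∀ l i, e l i = (l i : ℕ)) (p : (Fin d → Fin D) → ℤ)
    (i : Fin d) (hD : 0 < D) : (∑ l, MvPolynomial.monomial (e l) (p l)).degreeOf i < D := by
  rw [MvPolynomial.degreeOf_lt_iff hD]
  intro m hm
  by_contra hlt
  push Not at hlt
  have hne : ∀ l : Fin d → Fin D, e l ≠ m := fun l h => by
    have h1 := (l i).isLt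
    rw [← h, he] at hlt
    omega
  exact (MvPolynomial.mem_support_iff.mp hm) (coeff_auxPoly_eq_zero p m hne)

/-- Evaluation: `P(f₁, …, f_d) = ∑_λ p(λ) ∏ᵢ fᵢ^{λᵢ}`. [folklore] -/
theorem aeval_auxPoly (he : ∀ l i, e l i = (l i : ℕ)) (p : (Fin d → Fin D) → ℤ)
    (f : Fin d → ℂ) :
    MvPolynomial.aeval f (∑ l, MvPolynomial.monomial (e l) (p l)) =
      ∑ l, (p l : ℂ) * ∏ i, f i ^ (l i : ℕ) := by
  simp only [map_sum, MvPolynomial.aeval_monomial, algebraMap_int_eq, eq_intCast]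
  refine Finset.sum_congr rfl fun l _ => ?_
  congr 1
  rw [Finsupp.prod_fintype _ _ fun i => pow_zero _]
  simp only [he]

end AuxPoly

/-! ### The frequencies `w_λ = λ₁x₁ + ⋯ + λ_d x_d` -/

section Freq

variable {n d D : ℕ}

/-- `∏ᵢ (e^{⟨xᵢ, z⟩})^{λᵢ} = e^{⟨w_λ, z⟩}` with `w_λ = λ₁x₁ + ⋯ + λ_d x_d` (coordinatewise
`w_{λ,m} = ∑ᵢ λᵢ x_{i,m}`). [folklore] -/
theorem prod_cexp_dotProduct_pow (x : Fin d → Fin n → ℂ) (l : Fin d → Fin D) (z : Fin n → ℂ) :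
    ∏ i, cexp (x i ⬝ᵥ z) ^ (l i : ℕ) =
      cexp ((fun m => ∑ i, ((l i : ℕ) : ℂ) * x i m) ⬝ᵥ z) := by
  have h1 : ∀ i, cexp (x i ⬝ᵥ z) ^ (l i : ℕ) = cexp (((l i : ℕ) : ℂ) * (x i ⬝ᵥ z)) := fun i => by
    rw [← Complex.exp_nat_mul]
  simp_rw [h1]
  rw [← Complex.exp_sum]
  congr 1
  simp only [dotProduct, Finset.mul_sum, Finset.sum_mul]
  rw [Finset.sum_comm]
  refine Finset.sum_congr rfl fun i _ => Finset.sum_congr rfl fun m _ => ?_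
  ring

/-- `‖w_{λ,m}‖ ≤ d · D · ‖x‖` (sup norms). [folklore] -/
theorem norm_freq_le (x : Fin d → Fin n → ℂ) (l : Fin d → Fin D) (m : Fin n) :
    ‖∑ i, ((l i : ℕ) : ℂ) * x i m‖ ≤ d * D * ‖x‖ := by
  calc ‖∑ i, ((l i : ℕ) : ℂ) * x i m‖ ≤ ∑ i, ‖((l i : ℕ) : ℂ) * x i m‖ := norm_sum_le _ _
    _ ≤ ∑ _i : Fin d, (D : ℝ) * ‖x‖ := Finset.sum_le_sum fun i _ => by
        rw [norm_mul, Complex.norm_natCast]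
        refine mul_le_mul ?_ ?_ (norm_nonneg _) (Nat.cast_nonneg _)
        · exact_mod_cast (l i).isLt.le
        · exact (norm_le_pi_norm (x i) m).trans (norm_le_pi_norm x i)
    _ = d * D * ‖x‖ := by
        rw [Finset.sum_const, Finset.card_univ, Fintype.card_fin, nsmul_eq_mul]; ring

end Freq

/-! ### Parameter bookkeeping -/

section Params

/-- **The final numerical inequality** of the proof of Corollaire 3.2: with
`V = U + H₀ + nρ + dD + nT + 4`, `T ≥ 8ρ + U + H₀ + nρ + dD + n + 2`, `P ≤ e^{H₀}`, `k ≥ e^V − 1`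
and `C ≤ e^{dD}` (the number of unknowns), the two error terms add up to at most `e^{−U}`.
[folklore] -/
theorem final_bound (n d D T Pb k : ℕ) {C U H₀ ρ V : ℝ} (hρ : 0 ≤ ρ) (hH : 0 ≤ H₀) (hU : 0 ≤ U)
    (hC0 : 0 ≤ C) (hC : C ≤ Real.exp (d * D)) (hPb : (Pb : ℝ) ≤ Real.exp H₀)
    (hk : Real.exp V ≤ k + 1) (hV : V = U + H₀ + n * ρ + d * D + n * T + 4)
    (hT : 8 * ρ + U + H₀ + n * ρ + d * D + n + 2 ≤ T) :
    (T : ℝ) ^ n * (2 * ((2 * C * (Real.exp ρ ^ n) * Pb + 1) / k)) +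
      C * Pb * (n * Real.exp ρ ^ n * (2 * Real.exp (-(T : ℝ)))) ≤ Real.exp (-U) := by
  have h48 : (48 : ℝ) ≤ Real.exp 4 := by
    have h := Real.exp_one_gt_d9
    have h4 : Real.exp 4 = Real.exp 1 ^ 4 := by rw [← Real.exp_nat_mul]; norm_num
    rw [h4]
    have h48' : (48 : ℝ) ≤ 2.7182818283 ^ 4 := by norm_num
    exact h48'.trans (pow_le_pow_left₀ (by norm_num) h.le 4)
  have h4e : (4 : ℝ) ≤ Real.exp 2 := by
    have h1 := Real.add_one_le_exp (1 : ℝ)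
    have h2 : Real.exp 2 = Real.exp 1 ^ 2 := by rw [← Real.exp_nat_mul]; norm_num
    rw [h2]
    nlinarith
  have hTexp : (T : ℝ) ^ n ≤ Real.exp (n * T) := by
    have h1 : (T : ℝ) ≤ Real.exp T := by linarith [Real.add_one_le_exp (T : ℝ)]
    calc (T : ℝ) ^ n ≤ Real.exp T ^ n := pow_le_pow_left₀ (Nat.cast_nonneg _) h1 n
      _ = Real.exp (n * T) := by rw [← Real.exp_nat_mul]
  have hnexp : (n : ℝ) ≤ Real.exp n := by linarith [Real.add_one_le_exp (n : ℝ)]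
  have hρexp : Real.exp ρ ^ n = Real.exp (n * ρ) := by rw [← Real.exp_nat_mul]
  have hV4 : 4 ≤ V := by
    have : 0 ≤ U + H₀ + n * ρ + d * D + n * T := by positivity
    linarith
  have hk2 : Real.exp V / 2 ≤ k := by
    have := Real.add_one_le_exp V
    linarith
  have hkpos : (0 : ℝ) < k := lt_of_lt_of_le (by positivity) hk2
  have hE1 : 1 ≤ Real.exp (d * D + n * ρ + H₀) := Real.one_le_exp (by positivity)
  -- first term
  have h1 : (T : ℝ) ^ n * (2 * ((2 * C * (Real.exp ρ ^ n) * Pb + 1) / k)) ≤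
      Real.exp (-U) / 4 := by
    have hX : 2 * C * (Real.exp ρ ^ n) * Pb + 1 ≤ 3 * Real.exp (d * D + n * ρ + H₀) := by
      have h1' : C * (Real.exp ρ ^ n) * Pb ≤ Real.exp (d * D + n * ρ + H₀) := by
        rw [Real.exp_add, Real.exp_add, hρexp]
        gcongr
      linarith
    calc (T : ℝ) ^ n * (2 * ((2 * C * (Real.exp ρ ^ n) * Pb + 1) / k))
        ≤ Real.exp (n * T) * (2 * ((3 * Real.exp (d * D + n * ρ + H₀)) / (Real.exp V / 2))) := by
          gcongr
      _ = 12 * (Real.exp (n * T) * Real.exp (d * D + n * ρ + H₀) / Real.exp V) := by ring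
      _ = 12 * Real.exp (n * T + (d * D + n * ρ + H₀) - V) := by
          rw [Real.exp_sub, ← Real.exp_add]
      _ = 12 * Real.exp (-4 + -U) := by
          congr 1; rw [hV]; ring_nf
      _ = 12 * Real.exp (-4) * Real.exp (-U) := by rw [Real.exp_add]; ring
      _ ≤ 1 / 4 * Real.exp (-U) := by
          gcongr
          rw [Real.exp_neg, mul_inv_le_iff₀ (Real.exp_pos 4)]
          linarith [h48]
      _ = Real.exp (-U) / 4 := by ring
  -- second term
  have h2 : C * Pb * (n * Real.exp ρ ^ n * (2 * Real.exp (-(T : ℝ)))) ≤ Real.exp (-U) / 2 := by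
    calc C * Pb * (n * Real.exp ρ ^ n * (2 * Real.exp (-(T : ℝ))))
        ≤ Real.exp (d * D) * Real.exp H₀ *
            (Real.exp n * Real.exp ρ ^ n * (2 * Real.exp (-(T : ℝ)))) := by
          gcongr
      _ = 2 * Real.exp (d * D + H₀ + n + n * ρ - T) := by
          rw [hρexp, Real.exp_sub, Real.exp_add, Real.exp_add, Real.exp_add, Real.exp_neg]
          ring
      _ ≤ 2 * Real.exp (-2 + -U) := by
          gcongr
          linarith
      _ = 2 * Real.exp (-2) * Real.exp (-U) := by rw [Real.exp_add]; ring
      _ ≤ 1 / 2 * Real.exp (-U) := by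
          gcongr
          rw [Real.exp_neg, mul_inv_le_iff₀ (Real.exp_pos 2)]
          linarith [h4e]
      _ = Real.exp (-U) / 2 := by ring
  have := Real.exp_pos (-U)
  linarith

/-- **The dimension count** of the box principle in the proof of Corollaire 3.2
(`2 Tⁿ V ≤ D^d H₀`, i.e. "number of conditions × required precision ≤ number of unknowns ×
allowed height"): with `u = A ℓ^{n+2}`, `H₀ = N u`, `U = H₀ ℓ^{m}` (`m = d − n ≥ 1`),
`A^m = Nⁿ`, `T ≤ U + c₁H₀ ≤ 2U`, `V ≤ U + c₁H₀ + nT`, and `ℓ ≥ c₁, 2^{n+2}(n+1)`.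
[folklore] -/
theorem card_ineq (n m : ℕ) (hm : m ≠ 0) {N A ℓ c₁ D T V H₀ U : ℝ} (hℓ1 : 1 ≤ ℓ) (hc₁ : c₁ ≤ ℓ)
    (hc₂ : (2 : ℝ) ^ (n + 2) * (n + 1) ≤ ℓ) (hN1 : 1 ≤ N) (hA1 : 1 ≤ A) (hAe : A ^ m = N ^ n)
    (hH₀ : H₀ = N * (A * ℓ ^ (n + 2))) (hU : U = H₀ * ℓ ^ m)
    (hD : A * ℓ ^ (n + 2) ≤ D) (hT0 : 0 ≤ T) (hV0 : 0 ≤ V)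
    (hT : T ≤ U + c₁ * H₀) (hV : V ≤ U + c₁ * H₀ + n * T) :
    2 * T ^ n * V ≤ D ^ (n + m) * H₀ := by
  set u := A * ℓ ^ (n + 2) with hu
  have hℓ0 : 0 ≤ ℓ := zero_le_one.trans hℓ1
  have hu1 : 1 ≤ u := one_le_mul_of_one_le_of_one_le hA1 (one_le_pow₀ hℓ1)
  have hu0 : 0 ≤ u := zero_le_one.trans hu1
  have hH₀1 : 1 ≤ H₀ := by rw [hH₀]; exact one_le_mul_of_one_le_of_one_le hN1 hu1
  have hH₀0 : 0 ≤ H₀ := zero_le_one.trans hH₀1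
  have hℓm : ℓ ≤ ℓ ^ m := le_self_pow₀ hℓ1 hm
  have hc₁U : c₁ * H₀ ≤ U := by
    rw [hU]
    calc c₁ * H₀ ≤ ℓ * H₀ := by gcongr
      _ ≤ ℓ ^ m * H₀ := by gcongr
      _ = H₀ * ℓ ^ m := mul_comm _ _
  have hU0 : 0 ≤ U := by rw [hU]; positivity
  have hT2 : T ≤ 2 * U := by linarith
  have hV2 : V ≤ (2 * n + 2) * U := by
    have : (n : ℝ) * T ≤ n * (2 * U) := by gcongr
    nlinarith
  have hc₂' : (2 : ℝ) ^ (n + 2) * (n + 1) ≤ ℓ ^ m := hc₂.trans hℓm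
  have hum : u ^ m = N ^ n * ℓ ^ ((n + 2) * m) := by
    rw [hu, mul_pow, hAe, ← pow_mul]
  have hN0 : 0 ≤ N := zero_le_one.trans hN1
  calc 2 * T ^ n * V ≤ 2 * (2 * U) ^ n * ((2 * n + 2) * U) := by gcongr
    _ = (2 : ℝ) ^ (n + 2) * (n + 1) * (N ^ (n + 1) * u ^ (n + 1) * ℓ ^ (m * (n + 1))) := by
        rw [hU, hH₀]; ring
    _ ≤ ℓ ^ m * (N ^ (n + 1) * u ^ (n + 1) * ℓ ^ (m * (n + 1))) := by gcongr
    _ = N * u ^ (n + 1) * (N ^ n * ℓ ^ ((n + 2) * m)) := by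
        have : ℓ ^ ((n + 2) * m) = ℓ ^ m * ℓ ^ (m * (n + 1)) := by
          rw [← pow_add]; congr 1; ring
        rw [this]; ring
    _ = N * u ^ (n + 1) * u ^ m := by rw [hum]
    _ = u ^ (n + m) * (N * u) := by ring
    _ ≤ D ^ (n + m) * (N * u) := by gcongr
    _ = D ^ (n + m) * H₀ := by rw [hH₀]

end Params

/-! ### Corollaire 3.2 -/

/-- **Corollaire 3.2 of [Waldschmidt1981] holds** (discharge of the named fact `cor_3_2`): for
`x₁, …, x_d ∈ ℂⁿ`, `d > n`, there are `N₀ > 0` and, for every `N ≥ N₀`, a non-zero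
`P_N ∈ ℤ[T₁, …, T_d]` with `deg_{Tᵢ} P_N < N^{n/(d−n)} (log N)^{n+2}`,
`log H(P_N) ≤ N^{d/(d−n)} (log N)^{n+2}` and `|P_N(e^{⟨x₁,z⟩}, …, e^{⟨x_d,z⟩})| ≤
exp(−N^{d/(d−n)} (log N)^{d+2})` for `‖z‖ ≤ N`. Proof as in the source's Théorème 3.1: the
coefficients `p(λ)` (`0 ≤ λᵢ < D`) are given by the box principle applied to the real and
imaginary parts of the truncated Taylor coefficients of `F_N` (`box_principle_complex`), and the
analytic estimate is `norm_expPoly_le`; the parameters are `D = ⌈N^{n/(d−n)}(log N)^{n+2}⌉`,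
`H = ⌊exp(N^{d/(d−n)}(log N)^{n+2})⌋`, truncation order `T ≍ U = N^{d/(d−n)}(log N)^{d+2}`,
precision `e^{−V}`, `V ≍ U`, the count closing by one spare factor `(log N)^{d−n}`.
[cite: Waldschmidt1981, §3 Théorème 3.1, Corollaire 3.2 (pp. 100–102)] -/
theorem cor_3_2_holds : cor_3_2 := by
  intro n d x hnd
  -- constants depending on `n, d, x` only
  set nx : ℝ := ‖x‖ with hnx
  have hnx0 : 0 ≤ nx := norm_nonneg _
  set c₁ : ℝ := (16 + 2 * n) * d * nx + 2 * d + n + 5 with hc₁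
  set c₂ : ℝ := 2 ^ (n + 2) * (n + 1) with hc₂
  have hc₁1 : 1 ≤ c₁ := by
    have : 0 ≤ (16 + 2 * (n : ℝ)) * d * nx + 2 * d + n := by positivity
    rw [hc₁]; linarith
  have hev : ∀ᶠ N : ℕ in Filter.atTop, max c₁ c₂ ≤ Real.log N :=
    (Real.tendsto_log_atTop.comp tendsto_natCast_atTop_atTop).eventually_ge_atTop _
  obtain ⟨N₀, hN₀⟩ := Filter.eventually_atTop.mp hev
  refine ⟨max N₀ 1, lt_of_lt_of_le Nat.one_pos (le_max_right _ _), fun N hN => ?_⟩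
  have hlogc : max c₁ c₂ ≤ Real.log N := hN₀ N ((le_max_left _ _).trans hN)
  set ℓ : ℝ := Real.log N with hℓ
  have hc₁ℓ : c₁ ≤ ℓ := (le_max_left _ _).trans hlogc
  have hc₂ℓ : c₂ ≤ ℓ := (le_max_right _ _).trans hlogc
  have hℓ1 : 1 ≤ ℓ := hc₁1.trans hc₁ℓ
  have hℓ0 : 0 ≤ ℓ := zero_le_one.trans hℓ1
  have hN1 : (1 : ℝ) ≤ N := by exact_mod_cast (le_max_right N₀ 1).trans hN
  have hNpos : (0 : ℝ) < N := by linarith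
  have hdn0 : (0 : ℝ) < (d : ℝ) - n := by
    have : (n : ℝ) < d := by exact_mod_cast hnd
    linarith
  -- the two real powers of `N`
  set A : ℝ := (N : ℝ) ^ ((n : ℝ) / (d - n)) with hA
  set B : ℝ := (N : ℝ) ^ ((d : ℝ) / (d - n)) with hB
  have hA1 : 1 ≤ A := Real.one_le_rpow hN1 (div_nonneg (Nat.cast_nonneg _) hdn0.le)
  have hAdn : A ^ (d - n) = (N : ℝ) ^ n := by
    rw [hA, ← Real.rpow_natCast, ← Real.rpow_mul hNpos.le, Nat.cast_sub hnd.le,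
      div_mul_cancel₀ _ hdn0.ne', Real.rpow_natCast]
  have hBA : B = N * A := by
    have hexp : (d : ℝ) / (d - n) = (n : ℝ) / (d - n) + 1 := by
      rw [div_add_one hdn0.ne']; congr 1; ring
    rw [hB, hA, hexp, Real.rpow_add_one hNpos.ne', mul_comm]
  -- the parameters
  set D₀ : ℝ := A * ℓ ^ (n + 2) with hD₀
  have hD₀1 : 1 ≤ D₀ := one_le_mul_of_one_le_of_one_le hA1 (one_le_pow₀ hℓ1)
  set D : ℕ := ⌈D₀⌉₊ with hD
  have hD₀D : D₀ ≤ D := Nat.le_ceil _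
  have hDlt : (D : ℝ) < D₀ + 1 := Nat.ceil_lt_add_one (by linarith)
  have hDpos : 0 < D := by
    have : (0 : ℝ) < D := by linarith
    exact_mod_cast this
  have hD2 : (D : ℝ) ≤ 2 * D₀ := by linarith
  set H₀ : ℝ := B * ℓ ^ (n + 2) with hH₀
  have hH₀' : H₀ = N * D₀ := by rw [hH₀, hBA, hD₀]; ring
  have hD₀H₀ : D₀ ≤ H₀ := by
    rw [hH₀']; exact le_mul_of_one_le_left (by linarith) hN1
  have hH₀1 : 1 ≤ H₀ := hD₀1.trans hD₀H₀
  have hH₀0 : 0 ≤ H₀ := by linarith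
  set U : ℝ := B * ℓ ^ (d + 2) with hU
  have hU' : U = H₀ * ℓ ^ (d - n) := by
    rw [hU, hH₀, mul_assoc, ← pow_add]
    congr 2; omega
  have hU0 : 0 ≤ U := by rw [hU']; positivity
  set Pb : ℕ := ⌊Real.exp H₀⌋₊ with hPb
  have hPble : (Pb : ℝ) ≤ Real.exp H₀ := Nat.floor_le (Real.exp_pos _).le
  have hPblt : Real.exp H₀ < Pb + 1 := Nat.lt_floor_add_one _
  set ρ : ℝ := d * D * nx * N with hρ
  have hρ0 : 0 ≤ ρ := by positivity
  have hρle : ρ ≤ 2 * d * nx * H₀ := by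
    rw [hρ, hH₀']
    calc (d : ℝ) * D * nx * N ≤ d * (2 * D₀) * nx * N := by gcongr
      _ = 2 * d * nx * (N * D₀) := by ring
  set Tr : ℝ := 8 * ρ + U + H₀ + n * ρ + d * D + n + 2 with hTr
  have hTr2 : 2 ≤ Tr := by
    have : 0 ≤ 8 * ρ + U + H₀ + n * ρ + d * D + n := by positivity
    rw [hTr]; linarith
  set T : ℕ := ⌈Tr⌉₊ with hT
  have hTrT : Tr ≤ T := Nat.le_ceil _
  have hTlt : (T : ℝ) < Tr + 1 := Nat.ceil_lt_add_one (by linarith)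
  have hT1 : 1 ≤ T := by
    have : (1 : ℝ) ≤ T := by linarith
    exact_mod_cast this
  have hT8 : 8 * ρ ≤ T := by
    have : 0 ≤ U + H₀ + n * ρ + d * D + n := by positivity
    linarith
  set V : ℝ := U + H₀ + n * ρ + d * D + n * T + 4 with hV
  have hV0 : 0 ≤ V := by positivity
  set k : ℕ := ⌊Real.exp V⌋₊ with hk
  have hkle : (k : ℝ) ≤ Real.exp V := Nat.floor_le (Real.exp_pos _).le
  have hklt : Real.exp V < k + 1 := Nat.lt_floor_add_one _
  have hkpos : 0 < k := Nat.floor_pos.mpr (Real.one_le_exp hV0)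
  -- `T ≤ U + c₁ H₀`, `V ≤ U + c₁ H₀ + n T`
  have hdD : (d : ℝ) * D ≤ 2 * d * H₀ := by
    calc (d : ℝ) * D ≤ d * (2 * D₀) := by gcongr
      _ ≤ d * (2 * H₀) := by gcongr
      _ = 2 * d * H₀ := by ring
  have hTb : (T : ℝ) ≤ U + c₁ * H₀ := by
    have h1 : (8 + n) * ρ ≤ (8 + n) * (2 * d * nx * H₀) := by gcongr
    have h3 : (n : ℝ) + 3 ≤ (n + 3) * H₀ := by
      have := mul_le_mul_of_nonneg_left hH₀1 (by positivity : (0 : ℝ) ≤ n + 3)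
      linarith only [this]
    have h4 : ((16 + 2 * n) * d * nx + 2 * d + n + 4) * H₀ ≤ c₁ * H₀ :=
      mul_le_mul_of_nonneg_right (by rw [hc₁]; linarith only) hH₀0
    calc (T : ℝ) ≤ Tr + 1 := hTlt.le
      _ = U + (8 + n) * ρ + H₀ + d * D + (n + 3) := by rw [hTr]; ring
      _ ≤ U + (8 + n) * (2 * d * nx * H₀) + H₀ + 2 * d * H₀ + (n + 3) * H₀ := by linarith
      _ = U + ((16 + 2 * n) * d * nx + 2 * d + n + 4) * H₀ := by ring
      _ ≤ U + c₁ * H₀ := by linarith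
  have hVb : V ≤ U + c₁ * H₀ + n * T := by
    have h1 : (n : ℝ) * ρ ≤ n * (2 * d * nx * H₀) := by gcongr
    have h4 : (1 + 2 * n * d * nx + 2 * d + 4) * H₀ ≤ c₁ * H₀ := by
      refine mul_le_mul_of_nonneg_right ?_ hH₀0
      have : 0 ≤ 16 * (d : ℝ) * nx + n := by positivity
      rw [hc₁]; linarith only [this]
    calc V = U + H₀ + n * ρ + d * D + n * T + 4 := hV
      _ ≤ U + H₀ + n * (2 * d * nx * H₀) + 2 * d * H₀ + n * T + 4 * H₀ := by linarith
      _ = U + (1 + 2 * n * d * nx + 2 * d + 4) * H₀ + n * T := by ring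
      _ ≤ U + c₁ * H₀ + n * T := by linarith
  -- the dimension count
  have hcount : 2 * (T : ℝ) ^ n * V ≤ (D : ℝ) ^ d * H₀ := by
    have h := card_ineq n (d - n) (by omega) hℓ1 hc₁ℓ (by rw [hc₂] at hc₂ℓ; exact_mod_cast hc₂ℓ)
      hN1 hA1 hAdn (by rw [hH₀', hD₀]) hU' hD₀D (Nat.cast_nonneg T) hV0 hTb hVb
    rwa [show n + (d - n) = d by omega] at h
  have hcard :
      k ^ (2 * Fintype.card (Fin n → Fin T)) < (Pb + 1) ^ Fintype.card (Fin d → Fin D) := by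
    simp only [Fintype.card_pi, Finset.prod_const, Finset.card_univ, Fintype.card_fin]
    have h1 : (k : ℝ) ^ (2 * T ^ n) ≤ Real.exp ((D : ℝ) ^ d * H₀) := by
      calc (k : ℝ) ^ (2 * T ^ n) ≤ Real.exp V ^ (2 * T ^ n) :=
            pow_le_pow_left₀ (Nat.cast_nonneg _) hkle _
        _ = Real.exp (((2 * T ^ n : ℕ) : ℝ) * V) := by rw [Real.exp_nat_mul]
        _ ≤ Real.exp ((D : ℝ) ^ d * H₀) := by
            apply Real.exp_le_exp.mpr
            push_cast
            linarith
    have h2 : Real.exp ((D : ℝ) ^ d * H₀) < ((Pb + 1 : ℕ) : ℝ) ^ (D ^ d) := by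
      rw [show (D : ℝ) ^ d * H₀ = ((D ^ d : ℕ) : ℝ) * H₀ by push_cast; ring, Real.exp_nat_mul]
      push_cast
      exact pow_lt_pow_left₀ hPblt (Real.exp_pos _).le (pow_ne_zero _ hDpos.ne')
    exact_mod_cast h1.trans_lt h2
  -- the truncated Taylor coefficients and the box principle
  set w : (Fin d → Fin D) → Fin n → ℂ := fun l m => ∑ i, ((l i : ℕ) : ℂ) * x i m with hw
  have hwρ : ∀ l m, ‖w l m‖ * N ≤ ρ := fun l m => by
    rw [hρ, hw]
    exact mul_le_mul_of_nonneg_right (norm_freq_le x l m) (Nat.cast_nonneg _)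
  set a : (Fin n → Fin T) → (Fin d → Fin D) → ℂ := fun κ l =>
    ∏ m, (w l m * N) ^ (κ m : ℕ) / ((κ m : ℕ).factorial : ℂ) with ha
  have haA : ∀ κ l, ‖a κ l‖ ≤ Real.exp ρ ^ n := by
    intro κ l
    rw [ha]
    dsimp only
    rw [norm_prod]
    calc ∏ m, ‖(w l m * N) ^ (κ m : ℕ) / ((κ m : ℕ).factorial : ℂ)‖
        ≤ ∏ _m : Fin n, Real.exp ρ := by
          refine Finset.prod_le_prod (fun _ _ => norm_nonneg _) fun m _ => ?_
          rw [norm_div, norm_pow, Complex.norm_natCast, norm_mul, Complex.norm_natCast]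
          exact (div_le_div_of_nonneg_right (pow_le_pow_left₀ (by positivity) (hwρ l m) _)
            (by positivity)).trans (Real.pow_div_factorial_le_exp ρ hρ0 _)
      _ = Real.exp ρ ^ n := by rw [Finset.prod_const, Finset.card_univ, Fintype.card_fin]
  obtain ⟨p, hp0, hpP, hpL⟩ := box_principle_complex a (by positivity) haA Pb k hkpos hcard
  -- the polynomial `P_N = ∑_λ p(λ) T^λ`
  set e : (Fin d → Fin D) → Fin d →₀ ℕ :=
    fun l => Finsupp.equivFunOnFinite.symm fun i => (l i : ℕ) with he_def
  have he : ∀ l i, e l i = (l i : ℕ) := fun l i => by simp [he_def]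
  set P : MvPolynomial (Fin d) ℤ := ∑ l, MvPolynomial.monomial (e l) (p l) with hP
  refine ⟨P, auxPoly_ne_zero he p hp0, ?_, ?_, ?_⟩
  · -- partial degrees
    intro i
    have h1 := degreeOf_auxPoly_lt he p i hDpos
    have h2 : (P.degreeOf i : ℝ) + 1 ≤ D := by exact_mod_cast h1
    linarith
  · -- height
    intro m hm
    have hc0 : P.coeff m ≠ 0 := MvPolynomial.mem_support_iff.mp hm
    have h1 : |((P.coeff m : ℤ) : ℝ)| ≤ Pb := by
      rw [← Int.cast_abs]; exact_mod_cast abs_coeff_auxPoly_le he p hpP m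
    have hpos : 0 < |((P.coeff m : ℤ) : ℝ)| := abs_pos.mpr (by exact_mod_cast hc0)
    calc Real.log |((P.coeff m : ℤ) : ℝ)| ≤ Real.log (Real.exp H₀) :=
          Real.log_le_log hpos (h1.trans hPble)
      _ = H₀ := Real.log_exp _
  · -- the upper bound for `|F_N|_N`
    intro z hz
    rw [hP, aeval_auxPoly he]
    simp_rw [prod_cexp_dotProduct_pow]
    have hmain := norm_expPoly_le w p N T Pb hρ0 hT8 hT1 hwρ hpP hpL z hz
    refine hmain.trans ?_
    have hC : (Fintype.card (Fin d → Fin D) : ℝ) ≤ Real.exp (d * D) := by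
      simp only [Fintype.card_pi, Finset.prod_const, Finset.card_univ, Fintype.card_fin]
      push_cast
      have h1 : (D : ℝ) ≤ Real.exp D := by linarith [Real.add_one_le_exp (D : ℝ)]
      calc (D : ℝ) ^ d ≤ Real.exp D ^ d := pow_le_pow_left₀ (Nat.cast_nonneg _) h1 d
        _ = Real.exp (d * D) := by rw [← Real.exp_nat_mul]
    exact final_bound n d D T Pb k hρ0 hH₀0 hU0 (Nat.cast_nonneg _) hC hPble hklt.le hV
      (by rw [← hTr]; exact hTrT)

end Literature.NumberTheory.Transcendental.Waldschmidt1981
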